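import Summits.ABC.IUTFork.Cor312LogKummerRouteGlobal
import HarnessLib

/-!
# [IUTchIII] Cor. 3.12 — when the GLOBAL single-image transport IS equivalent to the typed Corollary: attained hulls

Record-only file (D-0012) of the abc-iut cell (D-0067 adjudication, `HOME/plan/ADJUDICATION-SPEC.md` v2 §2 (G1′)/(G3)
REAL-CONTAINER clause; seat abc-iut-w5-d232; proof-only, 0 defs, fact-free); TAKES NO SIDE.

CONTEXT. abc-iut-w4-d022's `statement_of_globalVolumeTransport` (p413209) derives the typed Statement of
[IUTchIII] Cor. 3.12 (kurims `paper:url-4b091feeb646`, p. 174 l. 16–18) from the GLOBAL single-image transport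
«for some family of lattice positions `m(j, v_ℚ)`, `−|log(q)| ≤ procession-normalised ∑ᶠ μ^log(thetaRegion (m j v_ℚ))`»;
the interface-level certificates p413793 (abc-iut-w5-d087) and p414138 (this seat) show that this input is in general
STRICTLY STRONGER than the Statement — but both separate the two by NON-NESTED admissible regions (a degenerate hull
frame, resp. one-point Kummer images of finite log-volume), which the plan's (G3) REAL-CONTAINER clause discounts.

WHAT IS PROVED HERE (the honest complement). If at every packet `(j, v_ℚ)`, `j ∈ 𝔽_l^⋇`, the holomorphic hull
`^{n,∘}𝒰_{j,v_ℚ}` of the union of the possible images IS ITSELF one of the single Kummer images `thetaRegion m₀` — as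
happens whenever the admissible regions at a packet are the sets `λ·𝒪` totally ordered by inclusion, (Ind1), (Ind2)
act by isometries and the (Ind3)-family of images attains its largest member (the shape of the genuine `p`-adic
containers: [IUTchIII] Rmk. 3.9.5 (i) "the smallest subset of the form `λ·𝒪` that contains" the union) — then the
global single-image transport is EQUIVALENT to the typed Corollary (`globalVolumeTransport_iff_statement_of_hullAttained`):
the Statement hands back the family `m₀(j, v_ℚ)`. So at «real-container» instances the B-route's global input is
Statement-equivalent (G-LOCALISED in the sense of ADJUDICATION-SPEC v2 (G1″)), and the strictness of p413793/p414138 is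
exactly the non-nestedness of their regions. Nothing here concerns which case the assembled REAL setting is in.
[claim: Mochizuki2012, status: disputed] for the Corollary; everything proved here is bookkeeping [folklore].
-/

noncomputable section

namespace Summit.ABC.IUTFork.Cor312Vol

open Thm311 Cor312 Literature.IUT.LogThetaLattice

variable {T : ThetaIndex} {S : Situation T} {P : Cor312.Setting S}

/-- «The packet hull is attained by a single Kummer image»: at every `(j, v_ℚ)`, `j ∈ 𝔽_l^⋇`, some `thetaRegion m₀`
EQUALS the holomorphic hull of the union of the possible images (nested «`λ·𝒪`» containers with an attained largest
image). Stated inline as a hypothesis below; recorded here only as the docstring's name for it. [folklore] -/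
theorem logvol_thetaRegion_eq_thetaLocal_of_eq (H : BridgeHyps P) {m : ℤ} {i : Fin T.lstar} {vQ : T.VQ}
    (h : P.thetaRegion m (Setting.labelSucc i) vQ = P.thetaHull (Setting.labelSucc i) vQ) :
    (S.D P.n).logvol (Setting.labelSucc i) vQ (P.thetaRegion m (Setting.labelSucc i) vQ) =
      (P.thetaLocal (Setting.labelSucc i) vQ).untopD 0 := by
  rw [thetaLocal_untopD H, h]

/-- **Attained hulls: the typed Corollary IMPLIES the global single-image transport.** If at every packet some single
Kummer image is the packet hull, the Statement yields a family of lattice positions `m₀(j, v_ℚ)` — with finitely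
supported log-volumes (Prop. 3.9 (iii), from `ThetaFinite`) — satisfying the global inequality of p413209's
`statement_of_globalVolumeTransport`. [folklore] -/
theorem globalVolumeTransport_of_statement_of_hullAttained (H : BridgeHyps P)
    (hatt : ∀ (i : Fin T.lstar) (vQ : T.VQ), ∃ m : ℤ,
      P.thetaRegion m (Setting.labelSucc i) vQ = P.thetaHull (Setting.labelSucc i) vQ)
    (hS : P.Statement) :
    ∃ mf : Fin T.lstar → T.VQ → ℤ,
      (∀ i : Fin T.lstar, (Function.support fun vQ : T.VQ =>
        (S.D P.n).logvol (Setting.labelSucc i) vQ (P.thetaRegion (mf i vQ) (Setting.labelSucc i) vQ)).Finite) ∧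
      P.negLogQ ≤ processionNormalized fun i : Fin T.lstar => ∑ᶠ vQ : T.VQ,
        (S.D P.n).logvol (Setting.labelSucc i) vQ (P.thetaRegion (mf i vQ) (Setting.labelSucc i) vQ) := by
  choose mf hmf using hatt
  have key : (fun i : Fin T.lstar => fun vQ : T.VQ =>
      (S.D P.n).logvol (Setting.labelSucc i) vQ (P.thetaRegion (mf i vQ) (Setting.labelSucc i) vQ)) =
      fun i vQ => (P.thetaLocal (Setting.labelSucc i) vQ).untopD 0 :=
    funext fun i => funext fun vQ => logvol_thetaRegion_eq_thetaLocal_of_eq H (hmf i vQ)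
  refine ⟨mf, fun i => ?_, ?_⟩
  · have hi := congrFun key i
    rw [hi]
    exact H.finite.2 i
  · have h2 := hS.2
    unfold Setting.negLogTheta at h2
    rw [if_pos H.finite, WithTop.coe_le_coe] at h2
    have hfun : (fun i : Fin T.lstar => ∑ᶠ vQ : T.VQ,
        (S.D P.n).logvol (Setting.labelSucc i) vQ (P.thetaRegion (mf i vQ) (Setting.labelSucc i) vQ)) =
        fun i : Fin T.lstar => ∑ᶠ vQ : T.VQ, (P.thetaLocal (Setting.labelSucc i) vQ).untopD 0 :=
      funext fun i => congrArg _ (congrFun key i)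
    rw [hfun]
    exact h2

/-- **At attained-hull settings the GLOBAL single-image transport is EQUIVALENT to the typed Corollary 3.12**
(p413209's `statement_of_globalVolumeTransport` for «⟸», the previous theorem for «⟹»; admissibility of the Kummer
images and the bridge hypotheses as there). So the strictness certified by p413793 / p414138 is exactly the failure
of hull attainment (non-nested admissible regions); at nested «`λ·𝒪`» containers the B-route's global input is
Statement-equivalent. [folklore] -/
theorem globalVolumeTransport_iff_statement_of_hullAttained (H : BridgeHyps P) (hadm : ThetaRegionsAdm P)
    (hatt : ∀ (i : Fin T.lstar) (vQ : T.VQ), ∃ m : ℤ,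
      P.thetaRegion m (Setting.labelSucc i) vQ = P.thetaHull (Setting.labelSucc i) vQ) :
    (∃ mf : Fin T.lstar → T.VQ → ℤ,
      (∀ i : Fin T.lstar, (Function.support fun vQ : T.VQ =>
        (S.D P.n).logvol (Setting.labelSucc i) vQ (P.thetaRegion (mf i vQ) (Setting.labelSucc i) vQ)).Finite) ∧
      P.negLogQ ≤ processionNormalized fun i : Fin T.lstar => ∑ᶠ vQ : T.VQ,
        (S.D P.n).logvol (Setting.labelSucc i) vQ (P.thetaRegion (mf i vQ) (Setting.labelSucc i) vQ)) ↔
      P.Statement :=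
  ⟨fun ⟨mf, hsupp, hglob⟩ => statement_of_globalVolumeTransport H hadm mf hsupp hglob,
    globalVolumeTransport_of_statement_of_hullAttained H hatt⟩

/-- The attained-hull hypothesis holds in particular when the (Ind3)-union is itself a single Kummer image and the
possible images reduce to it with the hull of that image being itself (e.g. Team R's identified reading, or any
setting whose indeterminacies fix the images and whose frame has the image as a hull-set): a convenient sufficient
form over the frozen fields. [folklore] -/
theorem hullAttained_of_possibleImages_eq {m₀ : ℤ}
    (himg : ∀ (i : Fin T.lstar) (vQ : T.VQ),
      P.possibleImages (Setting.labelSucc i) vQ = {P.thetaRegion m₀ (Setting.labelSucc i) vQ})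
    (hhul : ∀ (i : Fin T.lstar) (vQ : T.VQ),
      (P.frame (Setting.labelSucc i) vQ).hull (P.thetaRegion m₀ (Setting.labelSucc i) vQ) =
        P.thetaRegion m₀ (Setting.labelSucc i) vQ) :
    ∀ (i : Fin T.lstar) (vQ : T.VQ), ∃ m : ℤ,
      P.thetaRegion m (Setting.labelSucc i) vQ = P.thetaHull (Setting.labelSucc i) vQ := fun i vQ =>
  ⟨m₀, by
    unfold Setting.thetaHull
    rw [himg i vQ, Set.sUnion_singleton, hhul i vQ]⟩

end Summit.ABC.IUTFork.Cor312Vol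

end
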